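import Summits.QuantumFields.BalabanUV.Beta.GAN24.AveragedPropagatorDecayCubic
import Summits.QuantumFields.BalabanUV.Beta.GAN24.ScalarUnitLatticeTower
import Summits.QuantumFields.BalabanUV.Beta.GAN24.InverseRate
import Literature.MathematicalPhysics.QuantumFieldTheory.Balaban1983to89.T4FlagMemoryPolyWeight

/-!
# G-an2-4 ∕ (CONV-C), road P2, VECTOR LAYER — THE TOWER `k ↦ c_{L^k}(1) = Q_{L^k}𝒢_{L^k}Q_{L^k}*` OF BAŁABAN's AVERAGED PROPAGATOR IN THE
# ROW's KERNEL CURRENCY ON A CUBIC UNIT TORUS (`U = 1`, `a = 1`): k-UNIFORM DECAY, GEOMETRIC ONE-STEP RATE `θ = L^{−1∕2}` WITH DECAY, AND THE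
# ENTRYWISE LIMIT `c_∞` WITH `‖(c_{L^k} − c_∞)(i,i′)‖ ≤ C₅·θ^k·e^{−δ₄|i₁ − i′₁|}`, `‖c_∞(i,i′)‖ ≤ C₅·e^{−δ₄|i₁ − i′₁|}` — UNCONDITIONAL;
# plus the CARRIER-FREE packaging lemmas that turn ANY two-level one-step law of the road-P2 shape into these three statements

G-an2-4 formalisation swarm `b2b-balaban-gan24-formalise-*`, leaf prover 06 (gen 37), crux team (2) under the coordinator ruling «YM REDIRECT»
(e34b3e0c; FREEZE (0) honoured — a `GAN24/` corollary importing EXISTING modules only; announced as INTENT 1 «VECTOR-DECAY-TOWER», journal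
2026-08-21 l.31140 ∕ scope split l.31289; the road-P2 chair `b2b-balaban-gan24-p2` (gen 30)'s Part 10 header: «The tower∕`θ` packaging and the
inverse `(Q𝒢Q*)⁻¹` in kernel currency are NOT in this file»).  This is the KERNEL-currency twin of leaf-04 (gen 50)'s sup-currency
`AveragedPropagatorTowerCubic` and the vector transfer of this lineage's scalar `ScalarUnitLatticeTower` (gen 36).
INPUTS, BY NAME and nothing else estimated: the chair's Part 10 `AveragedPropagatorDecayCubic.norm_covOp_succ_sub_apply_le_cubic`
(`∃ K δ₄ > 0, ∀ N R N₀ ≥ 1, ∀ i i′, ‖(covOp (R·N) T 1 − covOp N T 1) i i′‖ ≤ K·((R−1)∕(RN))·(2 + log(RN) + log N)·e^{−δ₄|rep i₁ − rep i′₁|_T}`,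
`T = fun _ : Fin (d+1) ⇒ N₀`; it consumes this lineage's `VectorRowDecayLetters.vectorRowDecay_one_cubic`) and `covOp_kernel_decay_cubic` (the
k-uniform bound clause); the real-variable lemmas `ScalarUnitLatticeTower.tower_rate_le` (gen 36), lit `T4FlagMemoryPolyWeight.succ_mul_pow_le`,
and `InverseRate.exists_limit_of_step_rate` (geometric Cauchy tail in a complete group).  THIS FILE:
 * §0 CARRIER-FREE PACKAGING over a level-indexed family `u : (n : ℕ) → [NeZero n] → E` in a seminormed group `E`: `level_congr`;
   **`norm_tower_step_le_of_twoLevel`** — a two-level law `‖u(R·N) − u(N)‖ ≤ A·((R−1)∕(RN))·(2 + log(RN) + log N)·w` gives, along `N = L^k`,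
   `R = L` (`L ≥ 1`), `‖u(L^{k+1}) − u(L^k)‖ ≤ 2A·(1 + log L)·(k+1)·L^{−k}·w`; **`norm_tower_step_le_geometric`** — a step bound `B·(k+1)·L^{−k}·w`
   with `L ≥ 2` is `≤ (B∕(1 − θ))·θ^k·w`, `θ = 1∕√L`; **`exists_tower_limit`** (`E` complete) — a geometric step bound `C·θ^k·w` gives a limit
   `u_∞` with `u(L^k) → u_∞`, `‖u(L^k) − u_∞‖ ≤ (C∕(1−θ))·θ^k·w`, `‖u_∞‖ ≤ ‖u(1)‖ + (C∕(1−θ))·w`.  The weight `w ≥ 0` is carried linearly, so a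
   decay factor `e^{−δ|y−y′|}` (kernel currency) or a sup bound `b` (sup currency) ride through unchanged; every later tower of the cell (the
   inverse `(Q𝒢Q*)⁻¹`, NE2's `Δ_K`, fine constituents) is a five-line instantiation.
 * §1 **`norm_covOp_tower_step_apply_le_cubic`** — `∃ K′ δ₄ > 0` (d): for every `L, N₀ ≥ 1`, every `k`, all unit bonds `i, i′` of the cubic torus,
   `‖(c_{L^{k+1}} − c_{L^k})(i,i′)‖ ≤ K′·(1 + log L)·(k+1)·L^{−k}·e^{−δ₄|rep i₁ − rep i′₁|_T}` (Part 10 at `N = L^k`, `R = L` via §0).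
 * §2 **`convC_shape_covOp_tower_decay_cubic`** — THE TWO (CONV-C) CLAUSES, ONE PAIR `(C₄, δ₄)`: `∃ δ₄ > 0` (d), `∀ L ≥ 2 ∃ C₄ > 0` (d, L),
   `∀ N₀ ≥ 1 ∀ k i i′`: `‖c_{L^k}(i,i′)‖ ≤ C₄·e^{−δ₄|…|}` ∧ `‖(c_{L^{k+1}} − c_{L^k})(i,i′)‖ ≤ C₄·(1∕√L)^k·e^{−δ₄|…|}`.
 * §3 **`tendsto_covOp_tower_decay_cubic`** — THE LIMIT WITH LOCALISATION: `∀ L ≥ 2 ∃ C₅ > 0` (d, L) `∀ N₀ ∃ c_∞` (a matrix on the unit bonds)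
   `∀ i i′`: `c_{L^k}(i,i′) → c_∞(i,i′)`, `‖c_{L^k}(i,i′) − c_∞(i,i′)‖ ≤ C₅·(1∕√L)^k·e^{−δ₄|…|}` (every `k`), `‖c_∞(i,i′)‖ ≤ C₅·e^{−δ₄|…|}`;
   `C₅ = 2C₄∕(1 − 1∕√L)`.  By uniqueness of limits in `ℂ` this `c_∞` IS (entrywise) the matrix `cinf` of leaf-04's `tendsto_covOp_tower_cubic`
   (test their `mulVec` statement on `Pi.single i′ 1`); here it acquires exponential localisation, uniformly in the unit torus.
READING.  The pair (§2) is the SHAPE of `GAN24/DirichletExhaustion.ConvC` ∕ of cell `BETA/AN2.md` §6's (CONV-C) for the VECTOR unit-lattice-read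
constituent `Q_k𝒢_kQ_k*` at `U = 1` on cubic unit tori, and §3 is the `|s_k − s_∞| ≤ c₀θ^k` END-grade currency of `Beta.RateCertificate` ∕
`Beta.Assembly.LimitForm.conv` with localisation — on Bałaban's object, not on a model, but at `U = 1` and read on the unit lattice only.
WHAT IS ALREADY IN THE TREE (NE2 lane, credited, not re-derived): the EXISTENCE of the tower limit of `covB (L^k) = covOp (L^k)`
(`AveragedPropagatorOneStepCubic.covOp_eq_covB`, `VariationalDelKBridge.lev_eq_pow`) with an ℓ²-OPERATOR-NORM rate `CQB(d,a)·L^{−k}` on every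
torus and every `a > 0` is `T4Continuum/Support/BalabanAveragedCoerciveTower.covBlev_tendsto` (uniform coercivity + the variational one-step bound;
inverses and `Δ_K` too: `BalabanHardMinimizer.DeltaKlev_tendsto`); by uniqueness of limits the `c_∞` below IS that `cinf` entrywise.  What THIS file
adds is the KERNEL currency the row asks for: exponential localisation `e^{−δ₄|i₁ − i′₁|}` of `c_{L^k}`, of the one-step differences and of the
limit, UNIFORMLY in the unit torus `N₀` — which neither the ℓ²-operator norm nor leaf-04's sup → sup currency controls.
HONEST SCOPE.  [folklore] corollary of tree theorems BY NAME (one `obtain` per input + real analysis); `U = 1`, `a = 1`, CUBIC unit tori in dimension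
`d + 1`, the unit torus FIXED along the tower, constants EXISTENTIAL (the suppliers'); `θ = L^{−1∕2}` is a typing convenience absorbing `(k+1)` (any
`θ > L⁻¹` would do; the one-step factor itself is `(1 + log L)(k+1)L^{−k}`); the carrier is the finite unit torus with complex entries, NOT B4's
`ℤ^d × Fin N` — so this is the SHAPE of `ConvC`, not an instance of that predicate, and the limit is NAMED on the fixed finite carrier, not identified
with any continuum or Bałaban kernel (R213-2 wording).  No inverse `(Q𝒢Q*)⁻¹`, no fine constituents `H_k` ∕ `G_k(1)`, no general `a`, non-abelian
nothing.  NOT (CONV-C) as typed (a statement about Bałaban's `(G_k, H_k, C^{(k)})` with their inputs discharged, at general `U` in the small-field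
region), NEVER «G-an2-4 closed», NOT NE2 ∕ NE3, NOT D1, NOT BetaPertH, NOT continuum, NOT Clay; 0 def, 0 `def … : Prop`, 0 cite tag, no sorry — not in
print, our bookkeeping.  HONEST DEPENDENCY: continuum YM on T⁴ ⇐ BetaPertH ∧ nine spine estimates (0/9 proved); BetaPertH ⇐ (D1) ∧ (D4) ∧ CAP+tail;
G-an2-4 gates asym, D1 and NE2/3/4.
-/

noncomputable section

open scoped BigOperators ComplexConjugate Matrix

namespace Summit.QuantumFields.BalabanUV.Beta.GAN24.AveragedPropagatorTowerDecayCubic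

open Filter
open Literature.MathematicalPhysics.QuantumFieldTheory.Balaban1983to89
open B5Prop11Plancherel (Tor)
open B6LowerBound2153Torus (rep)
open B4TorusKernel.MultiPeriod (torusSupNorm)
open Summit.QuantumFields.BalabanUV.Beta.GAN24.ScalarUnitLatticeTower (tower_rate_le)
open Summit.QuantumFields.BalabanUV.Beta.GAN24.InverseRate (exists_limit_of_step_rate)
open Summit.QuantumFields.BalabanUV.Beta.GAN24.AveragedPropagatorTwoLevel (covOp)
open Summit.QuantumFields.BalabanUV.Beta.GAN24.AveragedPropagatorDecayCubic (norm_covOp_succ_sub_apply_le_cubic covOp_kernel_decay_cubic)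
open T4FlagMemoryPolyWeight (succ_mul_pow_le)

/-! ## §0 Carrier-free packaging: a two-level one-step law `N ↦ R·N` read along the tower `N = L^k`, `R = L` -/

section Generic

variable {E : Type*} [SeminormedAddCommGroup E]

omit [SeminormedAddCommGroup E] in
/-- re-indexing a level-indexed family along an equality of levels (the `NeZero` instance is a proposition). [folklore] -/
theorem level_congr (u : (n : ℕ) → [NeZero n] → E) {n m : ℕ} [NeZero n] [NeZero m] (h : n = m) : u n = u m := by
  subst h; rfl

/-- **TOWER STEP FROM A TWO-LEVEL LAW** (carrier-free): if a level-indexed family `u` in a seminormed group obeys the two-level one-step law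
`‖u(R·N) − u(N)‖ ≤ A·((R−1)∕(R·N))·(2 + log(R·N) + log N)·w` for all levels `N, R ≥ 1` (a weight `w ≥ 0` carried linearly), then along the
tower `N = L^k`, `R = L` (`L ≥ 1`): `‖u(L^{k+1}) − u(L^k)‖ ≤ 2A·(1 + log L)·(k+1)·L^{−k}·w`
(`((L−1)∕L^{k+1})·(2 + (2k+1)log L) ≤ 2(1 + log L)(k+1)L^{−k}` is `ScalarUnitLatticeTower.tower_rate_le`). [folklore] -/
theorem norm_tower_step_le_of_twoLevel (u : (n : ℕ) → [NeZero n] → E) {A w : ℝ} (hA : 0 ≤ A) (hw : 0 ≤ w)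
    (h : ∀ (N R : ℕ) [NeZero N] [NeZero R],
      ‖u (R * N) - u N‖ ≤ A * (((R : ℝ) - 1) / ((R : ℝ) * N)) * (2 + Real.log ((R * N : ℕ) : ℝ) + Real.log (N : ℝ)) * w)
    (L : ℕ) [NeZero L] (k : ℕ) :
    ‖u (L ^ (k + 1)) - u (L ^ k)‖ ≤ 2 * A * (1 + Real.log (L : ℝ)) * ((k : ℝ) + 1) / (L : ℝ) ^ k * w := by
  have hL : (1 : ℝ) ≤ L := by exact_mod_cast Nat.one_le_iff_ne_zero.mpr (NeZero.ne L)
  have key := h (L ^ k) L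
  rw [level_congr u (pow_succ' L k)]
  push_cast at key
  rw [show (L : ℝ) * (L : ℝ) ^ k = (L : ℝ) ^ (k + 1) from (pow_succ' _ _).symm, Real.log_pow, Real.log_pow] at key
  have hr := tower_rate_le hL k
  calc ‖u (L * L ^ k) - u (L ^ k)‖
      ≤ A * (((L : ℝ) - 1) / (L : ℝ) ^ (k + 1)) * (2 + ((k + 1 : ℕ) : ℝ) * Real.log L + (k : ℝ) * Real.log L) * w := key
    _ = A * (((L : ℝ) - 1) / (L : ℝ) ^ (k + 1) * (2 + ((k : ℝ) + 1) * Real.log L + (k : ℝ) * Real.log L)) * w := by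
        push_cast; ring
    _ ≤ A * (2 * (1 + Real.log L) * ((k : ℝ) + 1) / L ^ k) * w :=
        mul_le_mul_of_nonneg_right (mul_le_mul_of_nonneg_left hr hA) hw
    _ = 2 * A * (1 + Real.log (L : ℝ)) * ((k : ℝ) + 1) / (L : ℝ) ^ k * w := by ring

/-- **GEOMETRIC FORM OF THE TOWER STEP** (carrier-free): a step bound `B·(k+1)·L^{−k}·w` along the tower with `L ≥ 2` is geometric with ratio
`θ = L^{−1∕2}`: `‖u(L^{k+1}) − u(L^k)‖ ≤ (B∕(1 − θ))·θ^k·w` (`(k+1)L^{−k} = ((k+1)θ^k)·θ^k ≤ θ^k∕(1 − θ)`, the tree's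
`T4FlagMemoryPolyWeight.succ_mul_pow_le`). [folklore] -/
theorem norm_tower_step_le_geometric (u : (n : ℕ) → [NeZero n] → E) {B w : ℝ} (hB : 0 ≤ B) (hw : 0 ≤ w) (L : ℕ) [NeZero L]
    (hL2 : 2 ≤ L) (h : ∀ k : ℕ, ‖u (L ^ (k + 1)) - u (L ^ k)‖ ≤ B * ((k : ℝ) + 1) / (L : ℝ) ^ k * w) (k : ℕ) :
    ‖u (L ^ (k + 1)) - u (L ^ k)‖ ≤ B / (1 - (Real.sqrt L)⁻¹) * ((Real.sqrt L)⁻¹) ^ k * w := by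
  have hL1 : (1 : ℝ) < L := by exact_mod_cast hL2
  have hL0 : (0 : ℝ) < L := by linarith
  set y : ℝ := (Real.sqrt L)⁻¹ with hy
  have hsq : 1 < Real.sqrt L := by
    rw [show (1 : ℝ) = Real.sqrt 1 from Real.sqrt_one.symm]
    exact Real.sqrt_lt_sqrt zero_le_one hL1
  have hy0 : 0 < y := inv_pos.mpr (by linarith)
  have hy1 : y < 1 := inv_lt_one_of_one_lt₀ hsq
  have hyy : ((L : ℝ) ^ k)⁻¹ = y ^ k * y ^ k := by
    rw [hy, ← mul_pow, ← mul_inv, Real.mul_self_sqrt hL0.le, inv_pow]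
  have hgeo := succ_mul_pow_le hy0.le hy1 k
  have hyk : 0 ≤ y ^ k := pow_nonneg hy0.le k
  have hcoef : B * ((k : ℝ) + 1) / (L : ℝ) ^ k ≤ B / (1 - y) * y ^ k :=
    calc B * ((k : ℝ) + 1) / (L : ℝ) ^ k = B * (((k : ℝ) + 1) * y ^ k) * y ^ k := by
          rw [div_eq_mul_inv, hyy]; ring
      _ ≤ B * (1 / (1 - y)) * y ^ k := mul_le_mul_of_nonneg_right (mul_le_mul_of_nonneg_left hgeo hB) hyk
      _ = B / (1 - y) * y ^ k := by ring
  exact (h k).trans (mul_le_mul_of_nonneg_right hcoef hw)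

/-- **THE LIMIT ALONG THE TOWER** (carrier-free, complete group): a geometric step bound `‖u(L^{k+1}) − u(L^k)‖ ≤ C·θ^k·w` with `θ < 1` gives a
limit `u_∞` with `u(L^k) → u_∞`, `‖u(L^k) − u_∞‖ ≤ (C∕(1−θ))·θ^k·w` for every `k`, and `‖u_∞‖ ≤ ‖u(1)‖ + (C∕(1−θ))·w` — the tree's
`InverseRate.exists_limit_of_step_rate` on `k ↦ u(L^k)` plus the `k = 0` triangle inequality. [folklore] -/
theorem exists_tower_limit [CompleteSpace E] (u : (n : ℕ) → [NeZero n] → E) {C w θ : ℝ} (hθ1 : θ < 1) (L : ℕ) [NeZero L]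
    (h : ∀ k : ℕ, ‖u (L ^ (k + 1)) - u (L ^ k)‖ ≤ C * θ ^ k * w) :
    ∃ uinf : E, Tendsto (fun k : ℕ => u (L ^ k)) atTop (nhds uinf) ∧
      (∀ k : ℕ, ‖u (L ^ k) - uinf‖ ≤ C / (1 - θ) * θ ^ k * w) ∧ ‖uinf‖ ≤ ‖u 1‖ + C / (1 - θ) * w := by
  obtain ⟨uinf, hlim, htail⟩ := exists_limit_of_step_rate (fun k : ℕ => u (L ^ k)) (c := C * w) (θ := θ) hθ1
    (fun j => by have := h j; linarith [this])
  refine ⟨uinf, hlim, fun k => ?_, ?_⟩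
  · calc ‖u (L ^ k) - uinf‖ ≤ C * w * θ ^ k / (1 - θ) := htail k
      _ = C / (1 - θ) * θ ^ k * w := by ring
  · have h0 := htail 0
    rw [pow_zero θ, mul_one, level_congr u (pow_zero L)] at h0
    have htri : ‖uinf‖ ≤ ‖u 1‖ + ‖u 1 - uinf‖ := by
      have := norm_sub_le (u 1) (u 1 - uinf); rwa [sub_sub_cancel] at this
    calc ‖uinf‖ ≤ ‖u 1‖ + ‖u 1 - uinf‖ := htri
      _ ≤ ‖u 1‖ + C * w / (1 - θ) := add_le_add le_rfl h0
      _ = ‖u 1‖ + C / (1 - θ) * w := by ring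

end Generic

/-! ## §1 The tower step of `k ↦ c_{L^k}(1)` in kernel currency, on cubic unit tori -/

variable (d : ℕ)

/-- **THE TOWER STEP IN KERNEL CURRENCY, UNCONDITIONAL**: `∃ K′ δ₄ > 0` (functions of `d`) such that for every `L, N₀ ≥ 1`, every level `k` and all
unit bonds `i, i′` of the cubic torus `Π_{μ<d+1} ℤ∕N₀`:
`‖(c_{L^{k+1}}(1) − c_{L^k}(1))(i, i′)‖ ≤ K′·(1 + log L)·(k+1)·L^{−k}·e^{−δ₄·|rep i₁ − rep i′₁|_{T,∞}}` — the chair's Part 10 one-step kernel law at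
`N = L^k`, `R = L`, through §0. [folklore] -/
theorem norm_covOp_tower_step_apply_le_cubic :
    ∃ K δ₄ : ℝ, 0 < K ∧ 0 < δ₄ ∧ ∀ (L N₀ : ℕ) [NeZero L] [NeZero N₀] (k : ℕ) (i i' : Tor (fun _ : Fin (d + 1) => N₀) × Fin (d + 1)),
      ‖(covOp (L ^ (k + 1)) (fun _ : Fin (d + 1) => N₀) 1 - covOp (L ^ k) (fun _ : Fin (d + 1) => N₀) 1) i i'‖
        ≤ K * (1 + Real.log (L : ℝ)) * ((k : ℝ) + 1) / (L : ℝ) ^ k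
            * Real.exp (-(δ₄ * torusSupNorm (fun _ : Fin (d + 1) => N₀)
                (rep (fun _ : Fin (d + 1) => N₀) i.1 - rep (fun _ : Fin (d + 1) => N₀) i'.1))) := by
  obtain ⟨K, δ₄, hK, hδ₄, hEND⟩ := norm_covOp_succ_sub_apply_le_cubic d
  refine ⟨2 * K, δ₄, by positivity, hδ₄, fun L N₀ _ _ k i i' => ?_⟩
  have key := norm_tower_step_le_of_twoLevel (E := ℂ) (fun n _ => covOp n (fun _ : Fin (d + 1) => N₀) 1 i i') hK.le (Real.exp_pos _).le
    (fun N R _ _ => by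
      have h := hEND N R N₀ i i'
      rwa [Matrix.sub_apply] at h) L k
  rwa [Matrix.sub_apply]

/-! ## §2 The two clauses of the (CONV-C) shape in kernel currency, one pair `(C₄, δ₄)` -/

/-- **THE (CONV-C) TWO-CLAUSE SHAPE FOR `Q_k𝒢_kQ_k*` IN KERNEL CURRENCY ON CUBIC UNIT TORI, UNCONDITIONAL.**  There is a rate `δ₄ > 0` (a function
of `d`) such that for every `L ≥ 2` there is `C₄ > 0` (a function of `d, L`) with, for every `N₀ ≥ 1`, every level `k` and all unit bonds `i, i′`:
`‖c_{L^k}(1)(i, i′)‖ ≤ C₄·e^{−δ₄|rep i₁ − rep i′₁|_{T,∞}}` (k-UNIFORM DECAY — the chair's `covOp_kernel_decay_cubic`) and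
`‖(c_{L^{k+1}}(1) − c_{L^k}(1))(i, i′)‖ ≤ C₄·(1∕√L)^k·e^{−δ₄|rep i₁ − rep i′₁|_{T,∞}}` (GEOMETRIC ONE-STEP RATE WITH DECAY, `θ = L^{−1∕2}`);
`δ₄ = min` of the two suppliers' rates, `C₄ = max(K₀, K′(1 + log L)∕(1 − 1∕√L))`. [folklore] -/
theorem convC_shape_covOp_tower_decay_cubic :
    ∃ δ₄ : ℝ, 0 < δ₄ ∧ ∀ (L : ℕ) [NeZero L], 2 ≤ L → ∃ C₄ : ℝ, 0 < C₄ ∧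
      ∀ (N₀ : ℕ) [NeZero N₀] (k : ℕ) (i i' : Tor (fun _ : Fin (d + 1) => N₀) × Fin (d + 1)),
        ‖covOp (L ^ k) (fun _ : Fin (d + 1) => N₀) 1 i i'‖
            ≤ C₄ * Real.exp (-(δ₄ * torusSupNorm (fun _ : Fin (d + 1) => N₀)
                (rep (fun _ : Fin (d + 1) => N₀) i.1 - rep (fun _ : Fin (d + 1) => N₀) i'.1))) ∧
        ‖(covOp (L ^ (k + 1)) (fun _ : Fin (d + 1) => N₀) 1 - covOp (L ^ k) (fun _ : Fin (d + 1) => N₀) 1) i i'‖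
            ≤ C₄ * ((Real.sqrt L)⁻¹) ^ k * Real.exp (-(δ₄ * torusSupNorm (fun _ : Fin (d + 1) => N₀)
                (rep (fun _ : Fin (d + 1) => N₀) i.1 - rep (fun _ : Fin (d + 1) => N₀) i'.1))) := by
  obtain ⟨K₀, δ₀, hK₀, hδ₀, h0⟩ := covOp_kernel_decay_cubic d
  obtain ⟨K, δ', hK, hδ', h1⟩ := norm_covOp_tower_step_apply_le_cubic d
  refine ⟨min δ₀ δ', lt_min hδ₀ hδ', fun L _ hL2 => ?_⟩
  have hL1 : (1 : ℝ) < L := by exact_mod_cast hL2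
  have hlog : 0 ≤ Real.log (L : ℝ) := Real.log_nonneg hL1.le
  have hsq : 1 < Real.sqrt L := by
    rw [show (1 : ℝ) = Real.sqrt 1 from Real.sqrt_one.symm]
    exact Real.sqrt_lt_sqrt zero_le_one hL1
  have hy1 : (Real.sqrt L)⁻¹ < 1 := inv_lt_one_of_one_lt₀ hsq
  have h1y : 0 < 1 - (Real.sqrt L)⁻¹ := by linarith
  set B : ℝ := K * (1 + Real.log (L : ℝ)) with hB
  have hB0 : 0 ≤ B := by positivity
  set C₄ : ℝ := max K₀ (B / (1 - (Real.sqrt L)⁻¹)) with hC₄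
  have hC₄pos : 0 < C₄ := lt_max_of_lt_left hK₀
  refine ⟨C₄, hC₄pos, fun N₀ _ k i i' => ?_⟩
  set t := torusSupNorm (fun _ : Fin (d + 1) => N₀) (rep (fun _ : Fin (d + 1) => N₀) i.1 - rep (fun _ : Fin (d + 1) => N₀) i'.1)
  have ht : 0 ≤ t :=
    B4TorusKernel.MultiPeriod.torusSupNorm_nonneg (fun _ => Nat.one_le_iff_ne_zero.mpr (NeZero.ne N₀)) _
  have hE0 : Real.exp (-(δ₀ * t)) ≤ Real.exp (-(min δ₀ δ' * t)) :=
    Real.exp_le_exp.mpr (by nlinarith [min_le_left δ₀ δ'])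
  have hE' : Real.exp (-(δ' * t)) ≤ Real.exp (-(min δ₀ δ' * t)) :=
    Real.exp_le_exp.mpr (by nlinarith [min_le_right δ₀ δ'])
  refine ⟨(h0 (L ^ k) N₀ i i').trans (mul_le_mul (le_max_left _ _) hE0 (Real.exp_pos _).le hC₄pos.le), ?_⟩
  -- clause 2: §0 on the entry family `n ↦ c_n(1)(i, i′)`
  have hstep : ∀ k : ℕ, ‖covOp (L ^ (k + 1)) (fun _ : Fin (d + 1) => N₀) 1 i i' - covOp (L ^ k) (fun _ : Fin (d + 1) => N₀) 1 i i'‖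
      ≤ B * ((k : ℝ) + 1) / (L : ℝ) ^ k * Real.exp (-(δ' * t)) := fun k => by
    have h := h1 L N₀ k i i'
    rw [Matrix.sub_apply] at h
    calc _ ≤ _ := h
      _ = _ := by rw [hB]
  have hgeo := norm_tower_step_le_geometric (E := ℂ) (fun n _ => covOp n (fun _ : Fin (d + 1) => N₀) 1 i i') hB0 (Real.exp_pos _).le
    L hL2 hstep k
  rw [Matrix.sub_apply]
  refine hgeo.trans ?_
  have hθk : 0 ≤ ((Real.sqrt L)⁻¹) ^ k := pow_nonneg (inv_nonneg.mpr (Real.sqrt_nonneg _)) k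
  exact mul_le_mul (mul_le_mul_of_nonneg_right (le_max_right _ _) hθk) hE' (Real.exp_pos _).le (mul_nonneg hC₄pos.le hθk)

/-! ## §3 The limit along the tower, entrywise, with geometric rate and exponential localisation, uniformly in the unit torus -/

/-- **THE TOWER LIMIT OF BAŁABAN's AVERAGED PROPAGATOR IN KERNEL CURRENCY, `U = 1`, `a = 1`, CUBIC UNIT TORI — UNCONDITIONAL.**  There is
`δ₄ > 0` (a function of `d`) such that for every `L ≥ 2` there is `C₅ > 0` (a function of `d, L`) with: on every cubic unit torus `T = Π_{μ<d+1} ℤ∕N₀`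
there is a matrix `c_∞` on the unit bonds such that for all unit bonds `i, i′` and every level `k`,
`c_{L^k}(1)(i,i′) → c_∞(i,i′)` (`k → ∞`), `‖c_{L^k}(1)(i,i′) − c_∞(i,i′)‖ ≤ C₅·(1∕√L)^k·e^{−δ₄|rep i₁ − rep i′₁|_{T,∞}}` and
`‖c_∞(i,i′)‖ ≤ C₅·e^{−δ₄|rep i₁ − rep i′₁|_{T,∞}}` — §2 clause 2 summed geometrically (§0 `exists_tower_limit`, completeness of `ℂ`) and clause 1
passed to the limit; `C₅ = 2C₄∕(1 − 1∕√L)`.  The limit is NAMED on the fixed finite carrier, not identified; by `tendsto_nhds_unique` it coincides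
entrywise with the `cinf` of leaf-04's sup-currency `AveragedPropagatorTowerCubic.tendsto_covOp_tower_cubic`. [folklore] -/
theorem tendsto_covOp_tower_decay_cubic :
    ∃ δ₄ : ℝ, 0 < δ₄ ∧ ∀ (L : ℕ) [NeZero L], 2 ≤ L → ∃ C₅ : ℝ, 0 < C₅ ∧
      ∀ (N₀ : ℕ) [NeZero N₀],
        ∃ cinf : Matrix (Tor (fun _ : Fin (d + 1) => N₀) × Fin (d + 1)) (Tor (fun _ : Fin (d + 1) => N₀) × Fin (d + 1)) ℂ,
          ∀ (i i' : Tor (fun _ : Fin (d + 1) => N₀) × Fin (d + 1)),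
            Tendsto (fun k : ℕ => covOp (L ^ k) (fun _ : Fin (d + 1) => N₀) 1 i i') atTop (nhds (cinf i i')) ∧
            (∀ k : ℕ, ‖covOp (L ^ k) (fun _ : Fin (d + 1) => N₀) 1 i i' - cinf i i'‖
                ≤ C₅ * ((Real.sqrt L)⁻¹) ^ k * Real.exp (-(δ₄ * torusSupNorm (fun _ : Fin (d + 1) => N₀)
                    (rep (fun _ : Fin (d + 1) => N₀) i.1 - rep (fun _ : Fin (d + 1) => N₀) i'.1)))) ∧
            ‖cinf i i'‖ ≤ C₅ * Real.exp (-(δ₄ * torusSupNorm (fun _ : Fin (d + 1) => N₀)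
                (rep (fun _ : Fin (d + 1) => N₀) i.1 - rep (fun _ : Fin (d + 1) => N₀) i'.1))) := by
  obtain ⟨δ₄, hδ₄, hall⟩ := convC_shape_covOp_tower_decay_cubic d
  refine ⟨δ₄, hδ₄, fun L _ hL2 => ?_⟩
  obtain ⟨C₄, hC₄, h⟩ := hall L hL2
  have hL1 : (1 : ℝ) < L := by exact_mod_cast hL2
  set θ : ℝ := (Real.sqrt L)⁻¹ with hθ
  have hsq : 1 < Real.sqrt L := by
    rw [show (1 : ℝ) = Real.sqrt 1 from Real.sqrt_one.symm]
    exact Real.sqrt_lt_sqrt zero_le_one hL1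
  have hθ0 : 0 ≤ θ := inv_nonneg.mpr (Real.sqrt_nonneg _)
  have hθ1 : θ < 1 := inv_lt_one_of_one_lt₀ hsq
  have h1θ : 0 < 1 - θ := by linarith
  have hθle : (1 : ℝ) ≤ 1 / (1 - θ) := by rw [le_div_iff₀ h1θ]; linarith
  refine ⟨2 * C₄ / (1 - θ), by positivity, fun N₀ _ => ?_⟩
  have key : ∀ i i' : Tor (fun _ : Fin (d + 1) => N₀) × Fin (d + 1), ∃ s : ℂ,
      Tendsto (fun k : ℕ => covOp (L ^ k) (fun _ : Fin (d + 1) => N₀) 1 i i') atTop (nhds s) ∧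
      (∀ k : ℕ, ‖covOp (L ^ k) (fun _ : Fin (d + 1) => N₀) 1 i i' - s‖
          ≤ 2 * C₄ / (1 - θ) * θ ^ k * Real.exp (-(δ₄ * torusSupNorm (fun _ : Fin (d + 1) => N₀)
              (rep (fun _ : Fin (d + 1) => N₀) i.1 - rep (fun _ : Fin (d + 1) => N₀) i'.1)))) ∧
      ‖s‖ ≤ 2 * C₄ / (1 - θ) * Real.exp (-(δ₄ * torusSupNorm (fun _ : Fin (d + 1) => N₀)
          (rep (fun _ : Fin (d + 1) => N₀) i.1 - rep (fun _ : Fin (d + 1) => N₀) i'.1))) := by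
    intro i i'
    set w := Real.exp (-(δ₄ * torusSupNorm (fun _ : Fin (d + 1) => N₀)
      (rep (fun _ : Fin (d + 1) => N₀) i.1 - rep (fun _ : Fin (d + 1) => N₀) i'.1))) with hw
    have hw0 : 0 < w := Real.exp_pos _
    have hstep : ∀ k : ℕ, ‖covOp (L ^ (k + 1)) (fun _ : Fin (d + 1) => N₀) 1 i i' - covOp (L ^ k) (fun _ : Fin (d + 1) => N₀) 1 i i'‖
        ≤ C₄ * θ ^ k * w := fun k => by
      have h2 := (h N₀ k i i').2
      rwa [Matrix.sub_apply] at h2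
    obtain ⟨s, hs, htail, hs0⟩ := exists_tower_limit (E := ℂ) (fun n _ => covOp n (fun _ : Fin (d + 1) => N₀) 1 i i') hθ1 L hstep
    have hc1 : ‖covOp 1 (fun _ : Fin (d + 1) => N₀) 1 i i'‖ ≤ C₄ * w := by
      have := (h N₀ 0 i i').1
      rwa [level_congr (fun n _ => covOp n (fun _ : Fin (d + 1) => N₀) 1 i i') (pow_zero L)] at this
    refine ⟨s, hs, fun k => (htail k).trans ?_, hs0.trans ?_⟩
    · have hθk : 0 ≤ θ ^ k := pow_nonneg hθ0 k
      have : C₄ / (1 - θ) ≤ 2 * C₄ / (1 - θ) := by rw [div_le_div_iff_of_pos_right h1θ]; linarith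
      exact mul_le_mul_of_nonneg_right (mul_le_mul_of_nonneg_right this hθk) hw0.le
    · have hup : C₄ * w ≤ C₄ / (1 - θ) * w := by
        have := mul_le_mul_of_nonneg_left hθle (mul_nonneg hC₄.le hw0.le)
        calc C₄ * w = C₄ * w * 1 := by ring
          _ ≤ C₄ * w * (1 / (1 - θ)) := this
          _ = C₄ / (1 - θ) * w := by ring
      calc ‖covOp 1 (fun _ : Fin (d + 1) => N₀) 1 i i'‖ + C₄ / (1 - θ) * w ≤ C₄ / (1 - θ) * w + C₄ / (1 - θ) * w :=
            add_le_add (hc1.trans hup) le_rfl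
        _ = 2 * C₄ / (1 - θ) * w := by ring
  choose cinf hc using key
  exact ⟨Matrix.of fun i i' => cinf i i', fun i i' => hc i i'⟩

end Summit.QuantumFields.BalabanUV.Beta.GAN24.AveragedPropagatorTowerDecayCubic

end
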